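import Summits.Ventures.LatticeQCDFlow.Exactness.Phi4HMCPolyObsFloor
import Summits.Ventures.LatticeQCDFlow.Exactness.HMCMomentumMoments
import Summits.Ventures.LatticeQCDFlow.Scoring.FreeFieldHMCAutocorrelation
import Summits.Ventures.LatticeQCDFlow.Scoring.SchwingerDysonSpectralOracle
import Summits.Ventures.LatticeQCDFlow.Scoring.SchwingerDysonFreePropagator
import HarnessLib

/-!
# The zero mode of free-field HMC through one Metropolis-corrected trajectory: the mean squared jump of `M`, exactly

HONEST FRAMING: exact (Metropolis-corrected) sampling algorithms for lattice gauge theory;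
figures of merit are autocorrelation/cost numbers at stated couplings and volumes; no
continuum-physics claim.  (SCALAR calibration rung S0-A: not a gauge result.)

Venture `LatticeQCDFlow` (cell pub-lqcd), topic `Exactness`; FANOUT row 2 (`s0-phi4`, HMC arm:
dynamical exponent `z` of the magnetisation).  NEW WORK of the cell over row 2's own files
(`Scoring/FreeFieldLeapfrog` — exact mode decoupling and the rotation form of `N` qpq leapfrog steps;
`Scoring/SchwingerDysonSpectralOracle` — the mode-by-mode Schwinger–Dyson relation;
`Exactness/HMCMomentumMoments` — the refreshed momenta); nothing is cited as a fact.  Printed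
counterpart, NAMED ONLY: Kennedy–Pendleton 1991 (HMC on the Gaussian model, mode by mode).

Setting: the engine's FREE field on `n + 1` sites, `S(φ) = Σ_x [Σ_μ (φ(σ_μ x) − φ_x)² + m² φ_x²]`
(`J = shiftCoupling σ m²`, `λ = 0`; any family of shift bijections `σ_μ` — any dimension, periodic
b.c.), `H = S + ½Σp²`, row 2's HMC proposal `Ψ = hmcProposal J 0 δ N` (`N` qpq leapfrog steps of
size `δ`, momentum flip), `M = Σ_x φ_x` the total field (magnetisation, the ZERO MODE: `J𝟙 = m²𝟙`),
`P = Σ_x p_x` the total momentum, `V = n + 1`, `Ω₀² = 2m²`, stable regime `δ²Ω₀² < 4`,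
`θ = arccos(1 − δ²Ω₀²/2)`, `c = cos(Nθ)`, `s = sin(Nθ)`, `β = δ(1 − δ²Ω₀²/4)/sin θ`.

## What is proved (`m² > 0`)

* `momentum_force_eq`, `momentum_coord_mean`, `integral_total_mul_momentumWeight` — the refresh is
  centred: `∫ (Σ_x p_x) e^{−½Σp²} dp = 0` (Schwinger–Dyson equation of motion of the momentum law,
  no Gaussian integral computed);
* `free_coercive` — `m² Σφ² ≤ S` (the hypothesis of every `_of_coercive` lemma, `λ = 0` included);
  **`free_totalField_sq`** — `⟨M²⟩ = V/(2m²) = V/Ω₀²` (the spectral Schwinger–Dyson relation at the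
  zero mode); **`free_totalField_mean`** — `⟨M⟩ = 0`; `free_integral_totalField_sq` — unnormalised;
* **`free_totalField_hmcProposal`** — THE ZERO MODE THROUGH THE PROPOSAL, in closed form:
  `M((Ψ z).1) = c · M(z.1) + β s · P(z.2)` for every phase-space point `z`, every `N`;
* `rotation_beta_sq` — `β² = (1 − δ²Ω²/4)/Ω²` (`≤ 1/Ω²`);
* `free_integral_linear_sq` — `∫∫ (A·M + B·P)² e^{−H} = (A² V/(2m²) + B² V) · Z · Z_p` (the cross
  term dies: the refresh is centred); **`free_traj_msd_eq`** — THE MEAN SQUARED JUMP OF `M` PER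
  TRAJECTORY, EXACTLY: `∫∫ (M((Ψ z).1) − M(z.1))² e^{−H} = V · ((1 − c)²/(2m²) + β² s²) · Z · Z_p`
  (`free_integrable_traj_msd`: the integrand is integrable) — the input of the carré-du-champ
  floor of `Phi4HMCPolyObsFloor` for the free field; `FreeFieldHMCMagnetisationCSD.lean` bounds the
  ACCEPTED jump by it (`a ≤ 1`) and draws the floor `τ_int,traj(M) ≥ (1 + c)/(2(1 − c))` for the
  Metropolis-corrected chain.

NOT CLAIMED: anything at `λ > 0`; any other mode (the `κ ≠ 0` modes obey the same algebra with
`Ω_κ² = 2(κ + m²)` but are not typed here); the ACCEPTED jump (only its `a ≤ 1` majorant, next file).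
-/

namespace Summit.Ventures.LatticeQCDFlow.Exactness

open Real MeasureTheory Filter Finset
open Summit.Ventures.LatticeQCDFlow.Scoring

/-! ## §1 The momentum refresh is centred -/

section Momentum

variable {n : ℕ}

/-- The "force" of the kinetic action `½Σp²` is the momentum itself: `∂(½Σp²)/∂p_x = p_x`. -/
theorem momentum_force_eq (p : Fin (n + 1) → ℝ) (x : Fin (n + 1)) :
    latticePhi4Force (halfDiag n) 0 p x = p x := by
  unfold latticePhi4Force
  simp only [halfDiag_add_halfDiag, ite_mul, one_mul, zero_mul, Finset.sum_ite_eq,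
    Finset.mem_univ, if_true, mul_zero, add_zero]

/-- **The refreshed momenta are centred**: `⟨p_x⟩_p = 0` (equation of motion `⟨∂S_p/∂p_x⟩ = 0`). -/
theorem momentum_coord_mean (x : Fin (n + 1)) :
    gibbsExpect (halfDiag n) 0 (fun p => p x) = 0 := by
  have h := gibbs_eom_of_coercive (J := halfDiag n) (lam := 0) (ε := 1 / 2) (K := 0)
    (by norm_num) momentum_coercive x
  simp only [momentum_force_eq] at h
  exact h

/-- Unnormalised: `∫ p_x e^{−½Σp²} dp = 0`. -/
theorem integral_coord_mul_momentumWeight (x : Fin (n + 1)) :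
    ∫ p : Fin (n + 1) → ℝ, p x * momentumWeight p = 0 := by
  have hZ : 0 < gibbsZ (halfDiag n) 0 := gibbsZ_pos_of_coercive (by norm_num) momentum_coercive
  have h := momentum_coord_mean (n := n) x
  unfold gibbsExpect at h
  rw [div_eq_zero_iff] at h
  rcases h with h | h
  · rw [← h]
    exact integral_congr_ae (Eventually.of_forall fun p => by
      simp only [momentumWeight_eq_gibbsWeight])
  · exact absurd h hZ.ne'

/-- `p_x e^{−½Σp²}` is integrable. -/
theorem integrable_coord_mul_momentumWeight (x : Fin (n + 1)) :
    Integrable (fun p : Fin (n + 1) → ℝ => p x * momentumWeight p) := by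
  have h := integrable_pow_mul_pow_mul_gibbsWeight_of_coercive (J := halfDiag n) (lam := 0)
    (ε := 1 / 2) (K := 0) (by norm_num) momentum_coercive x x 1 0
  refine h.congr (Eventually.of_forall fun p => ?_)
  simp only [pow_one, pow_zero, mul_one, momentumWeight_eq_gibbsWeight]

/-- **The total momentum is centred**: `∫ (Σ_x p_x) e^{−½Σp²} dp = 0`. -/
theorem integral_total_mul_momentumWeight :
    ∫ p : Fin (n + 1) → ℝ, (∑ x, p x) * momentumWeight p = 0 := by
  simp_rw [Finset.sum_mul]
  rw [integral_finsetSum _ (fun x _ => integrable_coord_mul_momentumWeight x)]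
  exact Finset.sum_eq_zero fun x _ => integral_coord_mul_momentumWeight x

/-- `(Σ_x p_x)² e^{−½Σp²}` is integrable. -/
theorem integrable_totalSq_mul_momentumWeight :
    Integrable (fun p : Fin (n + 1) → ℝ => (∑ x, p x) ^ 2 * momentumWeight p) := by
  have h := polyObs_integrable_mul_mul_gibbsWeight (J := halfDiag n) (lam := 0) (ε := 1 / 2)
    (K := 0) (by norm_num) momentum_coercive polyObs_magnetisation polyObs_magnetisation
  refine h.congr (Eventually.of_forall fun p => ?_)
  simp only [momentumWeight_eq_gibbsWeight]
  ring

/-- `(Σ_x p_x) e^{−½Σp²}` is integrable. -/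
theorem integrable_total_mul_momentumWeight :
    Integrable (fun p : Fin (n + 1) → ℝ => (∑ x, p x) * momentumWeight p) := by
  have h := polyObs_integrable_mul_mul_gibbsWeight (J := halfDiag n) (lam := 0) (ε := 1 / 2)
    (K := 0) (by norm_num) momentum_coercive polyObs_magnetisation (polyObs_const 1)
  refine h.congr (Eventually.of_forall fun p => ?_)
  simp only [momentumWeight_eq_gibbsWeight, mul_one]

end Momentum

/-! ## §2 The free field: Gaussian moments of the zero mode -/

section Free

variable {n : ℕ} {ι : Type*} [Fintype ι]

/-- The constant vector is the zero mode of `−Δ_lat`: `Σ_μ (2 − 1 − 1) = 0`. -/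
theorem zeroMode_eigen (σ : ι → Equiv.Perm (Fin (n + 1))) (x : Fin (n + 1)) :
    ∑ μ : ι, (2 * (fun _ : Fin (n + 1) => (1 : ℝ)) x - (fun _ => (1 : ℝ)) (σ μ x)
      - (fun _ => (1 : ℝ)) ((σ μ).symm x)) = 0 * (fun _ : Fin (n + 1) => (1 : ℝ)) x := by
  rw [zero_mul]
  exact Finset.sum_eq_zero fun μ _ => by norm_num

/-- **The free action is coercive** with `ε = m²`, `K = 0`: `m² Σ φ² − 0 ≤ S(φ)`. -/
theorem free_coercive (σ : ι → Equiv.Perm (Fin (n + 1))) (m2 : ℝ) (φ : Fin (n + 1) → ℝ) :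
    m2 * ∑ w, φ w ^ 2 - 0 ≤ latticePhi4Action (shiftCoupling σ m2) 0 φ :=
  shiftCoupling_coercive_of_pos_mass σ le_rfl φ

/-- **`⟨M²⟩ = V/(2m²)`** for the free field (`m² > 0`): the spectral Schwinger–Dyson relation
`2(κ + m²)⟨(b·φ)²⟩ = Σ b²` at the zero mode `b = 𝟙`, `κ = 0`. -/
theorem free_totalField_sq (σ : ι → Equiv.Perm (Fin (n + 1))) {m2 : ℝ} (hm : 0 < m2) :
    gibbsExpect (shiftCoupling σ m2) 0 (fun φ => (∑ x, φ x) ^ 2) = ((n : ℝ) + 1) / (2 * m2) := by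
  have h := spectral_sd_shift_of_coercive σ (lam := 0) hm (free_coercive σ m2) (zeroMode_eigen σ)
  simp only [one_mul, zero_add, mul_zero, zero_mul, add_zero, one_pow, Finset.sum_const,
    Finset.card_univ, Fintype.card_fin, nsmul_eq_mul, mul_one] at h
  rw [eq_div_iff (by positivity), mul_comm]
  rw [h]
  push_cast
  ring

/-- **`⟨M⟩ = 0`** for the free field (`m² > 0`): `Σ_x ∂S/∂φ_x = 2m² M` and `⟨∂S/∂φ_x⟩ = 0`. -/
theorem free_totalField_mean (σ : ι → Equiv.Perm (Fin (n + 1))) {m2 : ℝ} (hm : 0 < m2) :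
    gibbsExpect (shiftCoupling σ m2) 0 (fun φ => ∑ x, φ x) = 0 := by
  have hco := free_coercive σ m2
  have hF : ∀ φ : Fin (n + 1) → ℝ,
      ∑ x, latticePhi4Force (shiftCoupling σ m2) 0 φ x = (2 * m2) * ∑ x, φ x := by
    intro φ
    have h := sum_mul_force_shift_of_eigen σ m2 0 (zeroMode_eigen σ) φ
    simp only [one_mul, zero_add, mul_zero, zero_mul, add_zero] at h
    exact h
  have hI : ∀ x, Integrable (fun φ : Fin (n + 1) → ℝ =>
      latticePhi4Force (shiftCoupling σ m2) 0 φ x * gibbsWeight (shiftCoupling σ m2) 0 φ) := by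
    intro x
    refine (integrable_pow_mul_pow_mul_force_mul_gibbsWeight_of_coercive hm hco x x x 0 0).congr
      (Eventually.of_forall fun φ => ?_)
    simp only [pow_zero, one_mul]
  have hsum : gibbsExpect (shiftCoupling σ m2) 0
      (fun φ => ∑ x, latticePhi4Force (shiftCoupling σ m2) 0 φ x) = 0 := by
    rw [gibbsExpect_sum (shiftCoupling σ m2) 0 Finset.univ (fun x _ => hI x)]
    exact Finset.sum_eq_zero fun x _ => gibbs_eom_of_coercive hm hco x
  have e : (fun φ : Fin (n + 1) → ℝ => ∑ x, latticePhi4Force (shiftCoupling σ m2) 0 φ x)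
      = fun φ => (2 * m2) * ∑ x, φ x := funext hF
  rw [e, gibbsExpect_const_mul] at hsum
  rcases mul_eq_zero.mp hsum with h | h
  · exfalso
    have : (0 : ℝ) < 2 * m2 := by positivity
    exact this.ne' h
  · exact h

/-- Unnormalised: `∫ M² e^{−S} = (V/(2m²)) Z`. -/
theorem free_integral_totalField_sq (σ : ι → Equiv.Perm (Fin (n + 1))) {m2 : ℝ} (hm : 0 < m2) :
    ∫ φ : Fin (n + 1) → ℝ, (∑ x, φ x) ^ 2 * gibbsWeight (shiftCoupling σ m2) 0 φ
      = ((n : ℝ) + 1) / (2 * m2) * gibbsZ (shiftCoupling σ m2) 0 := by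
  have hZ := gibbsZ_pos_of_coercive hm (free_coercive σ m2)
  have h := free_totalField_sq σ hm
  unfold gibbsExpect at h
  rwa [div_eq_iff hZ.ne'] at h

/-- `M² e^{−S}` is integrable (free field, `m² > 0`). -/
theorem free_integrable_totalField_sq (σ : ι → Equiv.Perm (Fin (n + 1))) {m2 : ℝ} (hm : 0 < m2) :
    Integrable (fun φ : Fin (n + 1) → ℝ => (∑ x, φ x) ^ 2 * gibbsWeight (shiftCoupling σ m2) 0 φ) := by
  refine (polyObs_integrable_mul_mul_gibbsWeight hm (free_coercive σ m2) polyObs_magnetisation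
    polyObs_magnetisation).congr (Eventually.of_forall fun φ => ?_)
  dsimp only
  ring

/-- `M e^{−S}` is integrable (free field, `m² > 0`). -/
theorem free_integrable_totalField (σ : ι → Equiv.Perm (Fin (n + 1))) {m2 : ℝ} (hm : 0 < m2) :
    Integrable (fun φ : Fin (n + 1) → ℝ => (∑ x, φ x) * gibbsWeight (shiftCoupling σ m2) 0 φ) := by
  refine (polyObs_integrable_mul_mul_gibbsWeight hm (free_coercive σ m2) polyObs_magnetisation
    (polyObs_const 1)).congr (Eventually.of_forall fun φ => ?_)
  simp only [mul_one]

/-! ## §3 The zero mode through the proposal -/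

/-- **THE ZERO MODE THROUGH ONE HMC PROPOSAL, IN CLOSED FORM** (free field, stable regime
`δ²·2m² < 4`): `M((Ψ z).1) = cos(Nθ) M(z.1) + β sin(Nθ) P(z.2)` with `θ = arccos(1 − δ²Ω₀²/2)`,
`β = δ(1 − δ²Ω₀²/4)/sin θ`, `Ω₀² = 2m²` — whatever the other modes do. -/
theorem free_totalField_hmcProposal (σ : ι → Equiv.Perm (Fin (n + 1))) {m2 δ : ℝ} (hδ : 0 < δ)
    (hm : 0 < m2) (hst : δ ^ 2 * (2 * m2) < 4) (N : ℕ)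
    (z : (Fin (n + 1) → ℝ) × (Fin (n + 1) → ℝ)) :
    ∑ x, (hmcProposal (shiftCoupling σ m2) 0 δ N z).1 x
      = Real.cos (N * Real.arccos (1 - δ ^ 2 * (2 * m2) / 2)) * ∑ x, z.1 x
        + δ * (1 - δ ^ 2 * (2 * m2) / 4) / Real.sin (Real.arccos (1 - δ ^ 2 * (2 * m2) / 2))
          * Real.sin (N * Real.arccos (1 - δ ^ 2 * (2 * m2) / 2)) * ∑ x, z.2 x := by
  have h1 : (hmcProposal (shiftCoupling σ m2) 0 δ N z).1
      = ((leapfrogQPQ (shiftCoupling σ m2) 0 δ)^[N] z).1 := by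
    simp [hmcProposal, momFlip]
  have h := congrArg Prod.fst (leapfrog_iterate_mode σ m2 δ (zeroMode_eigen σ) N z)
  simp only [one_mul, zero_add] at h
  rw [h1, h, lfMode_iterate_fst hδ (by positivity) hst]

/-- **`β² = (1 − δ²Ω²/4)/Ω²`** (`sin²θ = δ²Ω²(1 − δ²Ω²/4)`), stable regime. -/
theorem rotation_beta_sq {δ w2 : ℝ} (hδ : 0 < δ) (hw : 0 < w2) (hst : δ ^ 2 * w2 < 4) :
    (δ * (1 - δ ^ 2 * w2 / 4) / Real.sin (Real.arccos (1 - δ ^ 2 * w2 / 2))) ^ 2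
      = (1 - δ ^ 2 * w2 / 4) / w2 := by
  have hq : 0 < 1 - δ ^ 2 * w2 / 4 := by nlinarith
  have e : 1 - (1 - δ ^ 2 * w2 / 2) ^ 2 = δ ^ 2 * w2 * (1 - δ ^ 2 * w2 / 4) := by ring
  have h0 : 0 ≤ 1 - (1 - δ ^ 2 * w2 / 2) ^ 2 := by rw [e]; positivity
  rw [Real.sin_arccos, div_pow, Real.sq_sqrt h0, e]
  field_simp

/-- `β² ≤ 1/Ω²`. -/
theorem rotation_beta_sq_le {δ w2 : ℝ} (hδ : 0 < δ) (hw : 0 < w2) (hst : δ ^ 2 * w2 < 4) :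
    (δ * (1 - δ ^ 2 * w2 / 4) / Real.sin (Real.arccos (1 - δ ^ 2 * w2 / 2))) ^ 2 ≤ 1 / w2 := by
  rw [rotation_beta_sq hδ hw hst]
  refine div_le_div_of_nonneg_right ?_ hw.le
  nlinarith [sq_nonneg δ]

/-! ## §4 The mean squared jump of the zero mode per trajectory -/

/-- The product-space integrand `(A·M(φ) + B·P(p))² e^{−S(φ)} e^{−½Σp²}` is integrable
(free field, `m² > 0`). -/
theorem free_integrable_linear_sq (σ : ι → Equiv.Perm (Fin (n + 1))) {m2 : ℝ} (hm : 0 < m2)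
    (A B : ℝ) :
    Integrable (fun z : (Fin (n + 1) → ℝ) × (Fin (n + 1) → ℝ) =>
        (A * ∑ x, z.1 x + B * ∑ x, z.2 x) ^ 2
          * (gibbsWeight (shiftCoupling σ m2) 0 z.1 * momentumWeight z.2))
      ((volume : Measure (Fin (n + 1) → ℝ)).prod volume) := by
  set J := shiftCoupling σ m2 with hJ
  have hI1 : Integrable (fun z : (Fin (n + 1) → ℝ) × (Fin (n + 1) → ℝ) =>
      ((∑ x, z.1 x) ^ 2 * gibbsWeight J 0 z.1) * momentumWeight z.2)
      ((volume : Measure (Fin (n + 1) → ℝ)).prod volume) :=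
    (free_integrable_totalField_sq σ hm).mul_prod integrable_momentumWeight
  have hI2 : Integrable (fun z : (Fin (n + 1) → ℝ) × (Fin (n + 1) → ℝ) =>
      ((∑ x, z.1 x) * gibbsWeight J 0 z.1) * ((∑ x, z.2 x) * momentumWeight z.2))
      ((volume : Measure (Fin (n + 1) → ℝ)).prod volume) :=
    (free_integrable_totalField σ hm).mul_prod integrable_total_mul_momentumWeight
  have hI3 : Integrable (fun z : (Fin (n + 1) → ℝ) × (Fin (n + 1) → ℝ) =>
      gibbsWeight J 0 z.1 * ((∑ x, z.2 x) ^ 2 * momentumWeight z.2))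
      ((volume : Measure (Fin (n + 1) → ℝ)).prod volume) :=
    (integrable_gibbsWeight_of_coercive hm (free_coercive σ m2)).mul_prod
      integrable_totalSq_mul_momentumWeight
  refine (((hI1.const_mul (A ^ 2)).add (hI2.const_mul (2 * A * B))).add
    (hI3.const_mul (B ^ 2))).congr (Eventually.of_forall fun z => ?_)
  simp only [Pi.add_apply]
  ring

/-- A product-space Gaussian moment: for reals `A, B`,
`∫∫ (A·M(φ) + B·P(p))² e^{−S(φ)} e^{−½Σp²} = (A² V/(2m²) + B² V) · Z · Z_p` (free field; the cross
term dies because the refresh is centred). -/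
theorem free_integral_linear_sq (σ : ι → Equiv.Perm (Fin (n + 1))) {m2 : ℝ} (hm : 0 < m2)
    (A B : ℝ) :
    ∫ z : (Fin (n + 1) → ℝ) × (Fin (n + 1) → ℝ),
        (A * ∑ x, z.1 x + B * ∑ x, z.2 x) ^ 2
          * (gibbsWeight (shiftCoupling σ m2) 0 z.1 * momentumWeight z.2)
        ∂((volume : Measure (Fin (n + 1) → ℝ)).prod volume)
      = (A ^ 2 * (((n : ℝ) + 1) / (2 * m2)) + B ^ 2 * ((n : ℝ) + 1))
          * (gibbsZ (shiftCoupling σ m2) 0 * momentumZ n) := by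
  set J := shiftCoupling σ m2 with hJ
  have hI1 : Integrable (fun z : (Fin (n + 1) → ℝ) × (Fin (n + 1) → ℝ) =>
      ((∑ x, z.1 x) ^ 2 * gibbsWeight J 0 z.1) * momentumWeight z.2)
      ((volume : Measure (Fin (n + 1) → ℝ)).prod volume) :=
    (free_integrable_totalField_sq σ hm).mul_prod integrable_momentumWeight
  have hI2 : Integrable (fun z : (Fin (n + 1) → ℝ) × (Fin (n + 1) → ℝ) =>
      ((∑ x, z.1 x) * gibbsWeight J 0 z.1) * ((∑ x, z.2 x) * momentumWeight z.2))
      ((volume : Measure (Fin (n + 1) → ℝ)).prod volume) :=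
    (free_integrable_totalField σ hm).mul_prod integrable_total_mul_momentumWeight
  have hI3 : Integrable (fun z : (Fin (n + 1) → ℝ) × (Fin (n + 1) → ℝ) =>
      gibbsWeight J 0 z.1 * ((∑ x, z.2 x) ^ 2 * momentumWeight z.2))
      ((volume : Measure (Fin (n + 1) → ℝ)).prod volume) :=
    (integrable_gibbsWeight_of_coercive hm (free_coercive σ m2)).mul_prod
      integrable_totalSq_mul_momentumWeight
  have e : ∀ z : (Fin (n + 1) → ℝ) × (Fin (n + 1) → ℝ),
      (A * ∑ x, z.1 x + B * ∑ x, z.2 x) ^ 2 * (gibbsWeight J 0 z.1 * momentumWeight z.2)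
      = A ^ 2 * (((∑ x, z.1 x) ^ 2 * gibbsWeight J 0 z.1) * momentumWeight z.2)
        + 2 * A * B * (((∑ x, z.1 x) * gibbsWeight J 0 z.1) * ((∑ x, z.2 x) * momentumWeight z.2))
        + B ^ 2 * (gibbsWeight J 0 z.1 * ((∑ x, z.2 x) ^ 2 * momentumWeight z.2)) := by
    intro z
    ring
  simp_rw [e]
  have h12 : Integrable (fun z : (Fin (n + 1) → ℝ) × (Fin (n + 1) → ℝ) =>
      A ^ 2 * (((∑ x, z.1 x) ^ 2 * gibbsWeight J 0 z.1) * momentumWeight z.2)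
        + 2 * A * B * (((∑ x, z.1 x) * gibbsWeight J 0 z.1) * ((∑ x, z.2 x) * momentumWeight z.2)))
      ((volume : Measure (Fin (n + 1) → ℝ)).prod volume) :=
    (hI1.const_mul _).add (hI2.const_mul _)
  rw [integral_add h12 (hI3.const_mul _),
    integral_add (hI1.const_mul _) (hI2.const_mul _), integral_const_mul, integral_const_mul,
    integral_const_mul,
    integral_prod_mul (f := fun φ : Fin (n + 1) → ℝ => (∑ x, φ x) ^ 2 * gibbsWeight J 0 φ)
      (g := momentumWeight),
    integral_prod_mul (f := fun φ : Fin (n + 1) → ℝ => (∑ x, φ x) * gibbsWeight J 0 φ)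
      (g := fun p : Fin (n + 1) → ℝ => (∑ x, p x) * momentumWeight p),
    integral_prod_mul (f := gibbsWeight J 0)
      (g := fun p : Fin (n + 1) → ℝ => (∑ x, p x) ^ 2 * momentumWeight p),
    free_integral_totalField_sq σ hm, integral_total_mul_momentumWeight,
    integral_totalSq_mul_momentumWeight]
  unfold momentumZ gibbsZ
  ring

/-- **THE MEAN SQUARED JUMP OF THE ZERO MODE PER TRAJECTORY, EXACTLY** (free field, `m² > 0`,
stable regime, every `N`): with `c = cos(Nθ)`, `s = sin(Nθ)`,
`∫∫ (M((Ψ z).1) − M(z.1))² e^{−H(z)} dz = ((1 − c)² V/(2m²) + β² s² V) · Z · Z_p`. -/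
theorem free_traj_msd_eq (σ : ι → Equiv.Perm (Fin (n + 1))) {m2 δ : ℝ} (hδ : 0 < δ)
    (hm : 0 < m2) (hst : δ ^ 2 * (2 * m2) < 4) (N : ℕ) :
    ∫ z : (Fin (n + 1) → ℝ) × (Fin (n + 1) → ℝ),
        ((∑ x, (hmcProposal (shiftCoupling σ m2) 0 δ N z).1 x) - ∑ x, z.1 x) ^ 2
          * Real.exp (-phi4HmcEnergy (shiftCoupling σ m2) 0 z)
        ∂((volume : Measure (Fin (n + 1) → ℝ)).prod volume)
      = ((1 - Real.cos (N * Real.arccos (1 - δ ^ 2 * (2 * m2) / 2))) ^ 2 * (((n : ℝ) + 1) / (2 * m2))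
          + (δ * (1 - δ ^ 2 * (2 * m2) / 4) / Real.sin (Real.arccos (1 - δ ^ 2 * (2 * m2) / 2))
              * Real.sin (N * Real.arccos (1 - δ ^ 2 * (2 * m2) / 2))) ^ 2 * ((n : ℝ) + 1))
          * (gibbsZ (shiftCoupling σ m2) 0 * momentumZ n) := by
  set c := Real.cos (N * Real.arccos (1 - δ ^ 2 * (2 * m2) / 2)) with hc
  set b := δ * (1 - δ ^ 2 * (2 * m2) / 4) / Real.sin (Real.arccos (1 - δ ^ 2 * (2 * m2) / 2))
    * Real.sin (N * Real.arccos (1 - δ ^ 2 * (2 * m2) / 2)) with hb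
  have e : ∀ z : (Fin (n + 1) → ℝ) × (Fin (n + 1) → ℝ),
      ((∑ x, (hmcProposal (shiftCoupling σ m2) 0 δ N z).1 x) - ∑ x, z.1 x) ^ 2
          * Real.exp (-phi4HmcEnergy (shiftCoupling σ m2) 0 z)
      = ((c - 1) * ∑ x, z.1 x + b * ∑ x, z.2 x) ^ 2
          * (gibbsWeight (shiftCoupling σ m2) 0 z.1 * momentumWeight z.2) := by
    intro z
    rw [free_totalField_hmcProposal σ hδ hm hst N z, exp_neg_phi4HmcEnergy, hb]
    ring
  simp_rw [e]
  rw [free_integral_linear_sq σ hm]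
  ring

/-- The same integrand is integrable. -/
theorem free_integrable_traj_msd (σ : ι → Equiv.Perm (Fin (n + 1))) {m2 δ : ℝ} (hδ : 0 < δ)
    (hm : 0 < m2) (hst : δ ^ 2 * (2 * m2) < 4) (N : ℕ) :
    Integrable (fun z : (Fin (n + 1) → ℝ) × (Fin (n + 1) → ℝ) =>
        ((∑ x, (hmcProposal (shiftCoupling σ m2) 0 δ N z).1 x) - ∑ x, z.1 x) ^ 2
          * Real.exp (-phi4HmcEnergy (shiftCoupling σ m2) 0 z))
      ((volume : Measure (Fin (n + 1) → ℝ)).prod volume) := by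
  set c := Real.cos (N * Real.arccos (1 - δ ^ 2 * (2 * m2) / 2)) with hc
  set b := δ * (1 - δ ^ 2 * (2 * m2) / 4) / Real.sin (Real.arccos (1 - δ ^ 2 * (2 * m2) / 2))
    * Real.sin (N * Real.arccos (1 - δ ^ 2 * (2 * m2) / 2)) with hb
  refine (free_integrable_linear_sq σ hm (c - 1) b).congr (Eventually.of_forall fun z => ?_)
  dsimp only
  rw [free_totalField_hmcProposal σ hδ hm hst N z, exp_neg_phi4HmcEnergy, hb]
  ring

end Free

end Summit.Ventures.LatticeQCDFlow.Exactness
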